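import Literature.Analysis.FluidPDE.PeriodicLerayProfilePairing
import HarnessLib

/-!
# [BT1] Lemma 2.5 (Revised asymptotic profile), discharged

Analysis/FluidPDE proof file (theorems only): the **discharge of the named fact
`Literature.Analysis.FluidPDE.bradshawTsai2017_lemma_2_5`** (`PeriodicLerayExistence.lean`;
Bradshaw–Tsai, *Forward discretely self-similar solutions of the Navier–Stokes equations II*,
Ann. Henri Poincaré 18 (2017) = arXiv:1510.07504 [BT1], Lemma 2.5, p. 7–8 of the arXiv version):
for `U₀` under Assumption 2.1 with `q ∈ (3, ∞]` and `α ∈ (0,1)` there is `R₀ ≥ 1` such that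
`W = ξ_{R₀}U₀ + w` (`BradshawTsai2017.revisedProfile R₀ U₀`) satisfies the conclusions of
Lemma 2.5 (`IsRevisedProfile T q α W`) and `U₀ − W ∈ L^∞(0,T;L²)`:
`theorem bradshawTsai2017_lemma_2_5_holds : bradshawTsai2017_lemma_2_5`.

## The proof, clause by clause (printed proof p. 8)

* *`C¹`, `T`-periodic, divergence free*: `PeriodicLerayProfileRegularity.lean`
  (`contDiff_uncurry_revisedProfile`, `revisedProfile_add_period`, `isDivFree_revisedProfile`;
  "`div W = ∇ξ·U₀ + div w = 0`" through the `C¹_c` Poisson identity of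
  `PeriodicLerayProfilePotential.lean`).
* *"`‖W‖_{L^q} ≤ (1+c_q)Θ(R₀) ≤ α`"*: `‖ξU₀(s)‖_q ≤ ‖U₀(s)‖_{L^q(|y|≥R₀)} ≤ Θ(R₀)` and
  `‖w(s)‖_q ≤ K_q‖U₀(s)‖_{L^q(|y|≥R₀)}` (`PeriodicLerayProfileBounds.lean`, Young's inequality with
  a constant independent of `R₀` in place of Calderón–Zygmund), and `R₀ ≥ 1` is chosen with
  `(1 + K_q)Θ(R₀) ≤ α` (`Θ(R) → 0`; `exists_radius`).
* *"The second inequality [`L⁴`] follows immediately"*: the same two bounds with `q = 4`.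
* *`U₀ − W ∈ L^∞(0,T;L²)`*: `U₀ − W = (1−ξ)U₀ − w`, the first term bounded by `sup|U₀|` with
  support in `B̄_{2R₀}`, `‖w(s)‖_{L²} ≤ K₂ |B_{2R₀}|^{1/2} sup|U₀|` (sup over `ℝ × B̄_{2R₀}` by
  periodicity).
* *"`‖LW‖_{L^∞(0,T;H⁻¹)} ≤ c(R₀,U₀)`"*: `PeriodicLerayProfilePairing.lean` bounds `|⟨LW(s), ζ⟩|`
  by `(Bₜ + B_w + K₁B_ρ + 3K₂B_ρ)‖ζ‖_{H¹}` from four inputs on the slice `s`; here those inputs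
  are produced **uniformly in `s`** (`exists_lerayPairing_bound`): "both `U₀` and `∇U₀` belong to
  `L^∞_loc(ℝ³ × ℝ)`" — sup bounds `M₀`, `M₁`, `M₃` for `U₀`, `DU₀`, `D(∇ξ_R·U₀)` on
  `ℝ × B̄(0, 2R)` by periodicity and compactness (`exists_uniform_bounds`,
  `fderiv_uncurry_add_period`); `Bₜ`, `B_w` from the Young bounds of
  `PeriodicLerayProfileBounds.lean` and `‖1_{shell} f‖_{L²} ≤ |B_{2R}|^{1/2} sup|f|`; `K₁`, `K₂`
  from `|∇ξ_R| ≤ C_Z/R` supported in `|y| ≤ 2R` (where `1 ≤ (1+2R)²(1+|y|)⁻²`) and the decay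
  bounds `‖Dw(s)(y)‖ ≤ A(1+|y|)⁻²`, `‖Dw(s)(y) y‖ ≤ K_y(1+|y|)⁻²`.

## References

* Z. Bradshaw, T.-P. Tsai, Ann. Henri Poincaré 18 (2017) 1095–1119 = arXiv:1510.07504,
  Assumption 2.1, Lemma 2.5 and its proof [BradshawTsai2017AHP].
-/

noncomputable section

open MeasureTheory Set Function Filter Topology TopologicalSpace Metric InnerProductSpace
open scoped NNReal ENNReal RealInnerProductSpace Convolution

namespace Literature.Analysis.FluidPDE

namespace BradshawTsai2017

open NewtonGradPotential

variable {U₀ : ℝ → EuclideanSpace ℝ (Fin 3) → EuclideanSpace ℝ (Fin 3)} {R T : ℝ}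

/-! ### Periodicity of derivatives; uniform bounds on `ℝ × B̄(0, 2R)` -/

/-- The derivative of a `T`-periodic field is `T`-periodic. [folklore] -/
theorem fderiv_uncurry_add_period {F' : Type*} [NormedAddCommGroup F'] [NormedSpace ℝ F']
    {V : ℝ → EuclideanSpace ℝ (Fin 3) → F'} (hper : ∀ s y, V (s + T) y = V s y) (s : ℝ)
    (y : EuclideanSpace ℝ (Fin 3)) :
    fderiv ℝ (uncurry V) (s + T, y) = fderiv ℝ (uncurry V) (s, y) := by
  have e : uncurry V = fun p : ℝ × EuclideanSpace ℝ (Fin 3) => uncurry V (p + (T, 0)) := by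
    funext p
    simp only [uncurry_def, Prod.fst_add, Prod.snd_add, add_zero, hper]
  conv_rhs => rw [e, fderiv_comp_add_right]
  simp

/-- **"both `U₀` and `∇U₀` belong to `L^∞_loc(ℝ³ × ℝ)`"**: uniform bounds for `U₀`, `DU₀` and the
derivative of the density `G_R = ∇ξ_R·U₀` on `ℝ × B̄(0, 2R)` for a jointly `C¹`, `T`-periodic
`U₀`, `T > 0`. [cite: BradshawTsai2017AHP, proof of Lemma 2.5] -/
theorem exists_uniform_bounds (hU : ContDiff ℝ 1 (uncurry U₀)) (hT : 0 < T)
    (hper : ∀ s y, U₀ (s + T) y = U₀ s y) (R : ℝ) :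
    ∃ M₀ M₁ M₃ : ℝ, 0 ≤ M₀ ∧ 0 ≤ M₁ ∧ 0 ≤ M₃ ∧
      (∀ s, ∀ y ∈ closedBall (0 : EuclideanSpace ℝ (Fin 3)) (2 * R), ‖U₀ s y‖ ≤ M₀) ∧
      (∀ s, ∀ y ∈ closedBall (0 : EuclideanSpace ℝ (Fin 3)) (2 * R),
        ‖fderiv ℝ (uncurry U₀) (s, y)‖ ≤ M₁) ∧
      (∀ s, ∀ y ∈ closedBall (0 : EuclideanSpace ℝ (Fin 3)) (2 * R),
        ‖fderiv ℝ (uncurry fun s z => ⟪gradient (cutoffScaled R) z, U₀ s z⟫) (s, y)‖ ≤ M₃) := by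
  have hK : IsCompact (closedBall (0 : EuclideanSpace ℝ (Fin 3)) (2 * R)) := isCompact_closedBall _ _
  obtain ⟨M₀, hM₀0, hM₀⟩ := exists_forall_norm_le_of_periodic (F := uncurry U₀) hU.continuous hT
    (fun s y => hper s y) hK
  obtain ⟨M₁, hM₁0, hM₁⟩ := exists_forall_norm_le_of_periodic (F := fderiv ℝ (uncurry U₀))
    (hU.continuous_fderiv one_ne_zero) hT (fderiv_uncurry_add_period hper) hK
  have hG := contDiff_cutoffGradDensity hU R
  have hGper : ∀ s z, (fun s z => ⟪gradient (cutoffScaled R) z, U₀ s z⟫) (s + T) z =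
      (fun s z => ⟪gradient (cutoffScaled R) z, U₀ s z⟫) s z := fun s z => by
    simp only [hper]
  obtain ⟨M₃, hM₃0, hM₃⟩ := exists_forall_norm_le_of_periodic
    (F := fderiv ℝ (uncurry fun s z => ⟪gradient (cutoffScaled R) z, U₀ s z⟫))
    (hG.continuous_fderiv one_ne_zero) hT (fderiv_uncurry_add_period hGper) hK
  exact ⟨M₀, M₁, M₃, hM₀0, hM₁0, hM₃0, hM₀, hM₁, hM₃⟩

/-- `∫ |G_R(s)| ≤ (C_Z/R) M₀ |B(0,2R)|` when `|U₀(s)| ≤ M₀` on `B̄(0, 2R)`. [cite: BradshawTsai2017AHP, proof of Lemma 2.5] -/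
theorem integral_abs_density_le (hU : ContDiff ℝ 1 (uncurry U₀)) (hR : 0 < R) {C M₀ : ℝ}
    (hC : ∀ {R : ℝ}, 0 < R → ∀ z, ‖gradient (cutoffScaled R) z‖ ≤ C / R) {s : ℝ}
    (hM₀ : ∀ y ∈ closedBall (0 : EuclideanSpace ℝ (Fin 3)) (2 * R), ‖U₀ s y‖ ≤ M₀) :
    ∫ z, |⟪gradient (cutoffScaled R) z, U₀ s z⟫| ≤
      C / R * M₀ * (volume : Measure (EuclideanSpace ℝ (Fin 3))).real (closedBall 0 (2 * R)) := by
  have hC0 : 0 ≤ C := by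
    have := hC hR 0
    have h0 : 0 ≤ C / R := (norm_nonneg _).trans this
    exact (div_nonneg_iff.1 h0).elim (fun h => h.1) fun h => absurd h.2 (not_le.2 hR)
  have hpt : ∀ z, |⟪gradient (cutoffScaled R) z, U₀ s z⟫| ≤
      (closedBall (0 : EuclideanSpace ℝ (Fin 3)) (2 * R)).indicator (fun _ => C / R * M₀) z := by
    intro z
    by_cases hz : z ∈ closedBall (0 : EuclideanSpace ℝ (Fin 3)) (2 * R)
    · rw [indicator_of_mem hz]
      calc |⟪gradient (cutoffScaled R) z, U₀ s z⟫| ≤ ‖gradient (cutoffScaled R) z‖ * ‖U₀ s z‖ :=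
            abs_real_inner_le_norm _ _
        _ ≤ C / R * M₀ := mul_le_mul (hC hR z) (hM₀ z hz) (norm_nonneg _) (by positivity)
    · rw [indicator_of_notMem hz]
      rw [mem_closedBall_zero_iff, not_le] at hz
      rw [cutoffGradDensity_eq_zero hR (U₀ s) hz, abs_zero]
  have hint : Integrable (fun z => |⟪gradient (cutoffScaled R) z, U₀ s z⟫|) volume :=
    (((contDiff_gradient_cutoffScaled R).continuous.inner
      (contDiff_profileSlice hU s).continuous).abs).integrable_of_hasCompactSupport
      (hasCompactSupport_cutoffGradDensity hR (U₀ s)).abs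
  calc ∫ z, |⟪gradient (cutoffScaled R) z, U₀ s z⟫|
      ≤ ∫ z, (closedBall (0 : EuclideanSpace ℝ (Fin 3)) (2 * R)).indicator (fun _ => C / R * M₀) z :=
        integral_mono hint ((integrableOn_const measure_closedBall_lt_top.ne).integrable_indicator
          measurableSet_closedBall) hpt
    _ = C / R * M₀ * (volume : Measure (EuclideanSpace ℝ (Fin 3))).real (closedBall 0 (2 * R)) := by
        rw [integral_indicator measurableSet_closedBall, setIntegral_const, smul_eq_mul, mul_comm]

/-- On `B̄(0, ρ)`, `1 ≤ (1+ρ)² (1+|y|)⁻²`. [folklore] -/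
theorem one_le_bracket_mul {ρ : ℝ} {y : EuclideanSpace ℝ (Fin 3)} (hy : ‖y‖ ≤ ρ) :
    (1 : ℝ) ≤ (1 + ρ) ^ 2 * ((1 + ‖y‖) ^ 2)⁻¹ := by
  rw [← div_eq_mul_inv, one_le_div (by positivity)]
  exact pow_le_pow_left₀ (by positivity) (by linarith) 2

/-- `Dξ_R(y) ≠ 0` only on the shell `R < |y| < 2R`; in particular then `|y| ≤ 2R`. [cite: BradshawTsai2017AHP, §2 before Lemma 2.5] -/
theorem norm_le_of_fderiv_cutoffScaled_ne_zero (hR : 0 < R) {y : EuclideanSpace ℝ (Fin 3)}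
    (hy : fderiv ℝ (cutoffScaled R) y ≠ 0) : ‖y‖ ≤ 2 * R := by
  by_contra h
  exact hy (fderiv_cutoffScaled_eq_zero_of_ge hR (not_le.1 h).le)

/-- `‖Dξ_R(y)‖ ≤ C_Z/R` (the operator norm of `Dξ_R(y)` is `‖∇ξ_R(y)‖`). [cite: BradshawTsai2017AHP, §2 before Lemma 2.5] -/
theorem norm_fderiv_cutoffScaled_le {C : ℝ}
    (hC : ∀ {R : ℝ}, 0 < R → ∀ z, ‖gradient (cutoffScaled R) z‖ ≤ C / R) (hR : 0 < R)
    (y : EuclideanSpace ℝ (Fin 3)) : ‖fderiv ℝ (cutoffScaled R) y‖ ≤ C / R := by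
  have h := hC hR y
  rwa [gradient, LinearIsometryEquiv.norm_map] at h

/-! ### The `H⁻¹` bound, uniformly in `s` -/

/-- **"`‖LW‖_{L^∞(0,T;H⁻¹(ℝ³))} ≤ c(R₀,U₀)`"** ([BT1] Lemma 2.5, last bound): for `U₀` jointly
`C¹`, `T`-periodic (`T > 0`) and solving `LU₀ = 0` in the weak form (2.3), and `R > 0`, there is
`c` with `|⟨LW(s), ζ⟩| ≤ c‖ζ‖_{H¹}` for all `s` and all test fields `ζ`,
`W = revisedProfile R U₀`. [cite: BradshawTsai2017AHP, Lemma 2.5] -/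
theorem exists_lerayPairing_bound (hU : ContDiff ℝ 1 (uncurry U₀)) (hT : 0 < T)
    (hper : ∀ s y, U₀ (s + T) y = U₀ s y)
    (hleray : ∀ s, ∀ φ : EuclideanSpace ℝ (Fin 3) → EuclideanSpace ℝ (Fin 3),
      FunctionSpaces.IsTestFunctionOn (⊤ : Opens (EuclideanSpace ℝ (Fin 3))) φ →
      ∫ y, (⟪timeDeriv U₀ s y - U₀ s y - fderiv ℝ (U₀ s) y y, φ y⟫ +
        frobeniusInner (fderiv ℝ (U₀ s) y) (fderiv ℝ φ y)) = 0)
    (hR : 0 < R) :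
    ∃ c : ℝ≥0, ∀ s, ∀ ζ : EuclideanSpace ℝ (Fin 3) → EuclideanSpace ℝ (Fin 3),
      FunctionSpaces.IsTestFunctionOn (⊤ : Opens (EuclideanSpace ℝ (Fin 3))) ζ →
        |lerayPairing (revisedProfile R U₀) s ζ| ≤ c * h1Norm ζ := by
  set b := stdOrthonormalBasis ℝ (EuclideanSpace ℝ (Fin 3)) with hb
  obtain ⟨C_Z, hC_Z0, hC_Z⟩ := exists_norm_gradient_cutoffScaled_le
  obtain ⟨M₀, M₁, M₃, hM₀0, hM₁0, hM₃0, hM₀, hM₁, hM₃⟩ := exists_uniform_bounds hU hT hper R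
  obtain ⟨Kt, hKt⟩ := exists_eLpNorm_timeDeriv_profileCorrector_le
  obtain ⟨Kw, hKw⟩ := exists_eLpNorm_profileCorrector_le (q := 2) le_rfl
  -- the volume constant and the weight
  set vb : ℝ≥0∞ := volume (ball (0 : EuclideanSpace ℝ (Fin 3)) (2 * R)) with hvb
  have hvb_top : vb ≠ ⊤ := measure_ball_lt_top.ne
  set ρ : EuclideanSpace ℝ (Fin 3) → ℝ := fun y => ((1 + ‖y‖) ^ 2)⁻¹ with hρ
  have hρ0 : ∀ y, 0 ≤ ρ y := fun y => by rw [hρ]; positivity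
  have hρtop : eLpNorm ρ 2 volume < ⊤ := eLpNorm_bracket_lt_top
  set Bρ : ℝ := (eLpNorm ρ 2 volume).toReal with hBρ
  have hBρ0 : 0 ≤ Bρ := ENNReal.toReal_nonneg
  have hρle : eLpNorm ρ 2 volume ≤ ENNReal.ofReal Bρ := by
    rw [hBρ, ENNReal.ofReal_toReal hρtop.ne]
  -- `L²` bounds for `∂ₛw` and `w`
  set Bt : ℝ := (Kt * (vb ^ (1 / (2 : ℝ)) * ENNReal.ofReal M₁)).toReal with hBt
  set Bw : ℝ := (Kw * (vb ^ (1 / (2 : ℝ)) * ENNReal.ofReal M₀)).toReal with hBw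
  have hBt0 : 0 ≤ Bt := ENNReal.toReal_nonneg
  have hBw0 : 0 ≤ Bw := ENNReal.toReal_nonneg
  have hfin1 : (Kt : ℝ≥0∞) * (vb ^ (1 / (2 : ℝ)) * ENNReal.ofReal M₁) ≠ ⊤ :=
    ENNReal.mul_ne_top ENNReal.coe_ne_top (ENNReal.mul_ne_top
      (ENNReal.rpow_ne_top_of_nonneg (by norm_num) hvb_top) ENNReal.ofReal_ne_top)
  have hfin2 : (Kw : ℝ≥0∞) * (vb ^ (1 / (2 : ℝ)) * ENNReal.ofReal M₀) ≠ ⊤ :=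
    ENNReal.mul_ne_top ENNReal.coe_ne_top (ENNReal.mul_ne_top
      (ENNReal.rpow_ne_top_of_nonneg (by norm_num) hvb_top) ENNReal.ofReal_ne_top)
  have hV : ∀ s z, ‖z‖ ≤ 2 * R → ‖fderiv ℝ (uncurry U₀) (s, z) (1, 0)‖ ≤ M₁ := by
    intro s z hz
    refine (ContinuousLinearMap.le_opNorm _ _).trans ?_
    have h1 : ‖((1 : ℝ), (0 : EuclideanSpace ℝ (Fin 3)))‖ ≤ 1 := by
      rw [Prod.norm_mk, norm_one, norm_zero, max_eq_left zero_le_one]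
    calc ‖fderiv ℝ (uncurry U₀) (s, z)‖ * ‖((1 : ℝ), (0 : EuclideanSpace ℝ (Fin 3)))‖
        ≤ M₁ * 1 := mul_le_mul (hM₁ s z (mem_closedBall_zero_iff.2 hz)) h1 (norm_nonneg _) hM₁0
      _ = M₁ := mul_one _
  have h_t : ∀ s, eLpNorm (timeDeriv (profileCorrector R U₀) s) 2 volume ≤ ENNReal.ofReal Bt := by
    intro s
    rw [hBt, ENNReal.ofReal_toReal hfin1]
    refine (hKt hU hR s).trans (mul_le_mul' le_rfl ?_)
    have h := eLpNorm_indicator_shell_le_of_bound (hV s) 2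
    rwa [ENNReal.toReal_ofNat] at h
  have h_w : ∀ s, eLpNorm (profileCorrector R U₀ s) 2 volume ≤ ENNReal.ofReal Bw := by
    intro s
    rw [hBw, ENNReal.ofReal_toReal hfin2]
    refine (hKw (fun s => (contDiff_profileSlice hU s).continuous) hR s).trans
      (mul_le_mul' le_rfl ?_)
    have h := eLpNorm_indicator_shell_le_of_bound
      (fun z hz => hM₀ s z (mem_closedBall_zero_iff.2 hz)) 2
    rwa [ENNReal.toReal_ofNat] at h
  -- pointwise domination of the commutator terms
  set A : ℝ := max (5 * M₃ * (2 * R) * (1 + 2 * (2 * R)) ^ 2)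
    (4 / 3 * M₃ * (2 * R) ^ 3 * (1 + (2 * (2 * R))⁻¹) ^ 2) with hA
  have hA0 : 0 ≤ A := le_max_of_le_left (by positivity)
  set I₀ : ℝ := C_Z / R * M₀ *
    (volume : Measure (EuclideanSpace ℝ (Fin 3))).real (closedBall 0 (2 * R)) with hI₀
  have hI₀0 : 0 ≤ I₀ := by positivity
  set Ky : ℝ := 4 * R * A + 8 * I₀ / Real.pi * (1 + (4 * R)⁻¹) ^ 2 with hKy
  have hKy0 : 0 ≤ Ky := by positivity
  set K₁ : ℝ := (2 * C_Z * M₀ + 3 * (C_Z / R * M₁)) * (1 + 2 * R) ^ 2 + Ky with hK₁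
  set K₂ : ℝ := C_Z / R * M₀ * (1 + 2 * R) ^ 2 + A with hK₂
  have hK₁0 : 0 ≤ K₁ := by positivity
  have hK₂0 : 0 ≤ K₂ := by positivity
  have hMslice : ∀ s z, ‖fderiv ℝ (fun z => ⟪gradient (cutoffScaled R) z, U₀ s z⟫) z‖ ≤ M₃ := by
    intro s z
    by_cases hz : z ∈ closedBall (0 : EuclideanSpace ℝ (Fin 3)) (2 * R)
    · exact (norm_fderiv_timeSlice_le (contDiff_cutoffGradDensity hU R) s z).trans (hM₃ s z hz)
    · rw [mem_closedBall_zero_iff, not_le] at hz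
      rw [fderiv_cutoffGradDensity_eq_zero hR (U₀ s) hz, norm_zero]
      exact hM₃0
  have hDw : ∀ s y, ‖fderiv ℝ (profileCorrector R U₀ s) y‖ ≤ A * ρ y := fun s y =>
    norm_fderiv_profileCorrector_le hU hR (hMslice s) y
  have hDwy : ∀ s y, ‖fderiv ℝ (profileCorrector R U₀ s) y y‖ ≤ Ky * ρ y := fun s y =>
    norm_fderiv_profileCorrector_apply_self_le hU hR (hMslice s)
      (integral_abs_density_le hU hR hC_Z (hM₀ s)) y
  have hDU : ∀ s y, ‖y‖ ≤ 2 * R → ‖fderiv ℝ (U₀ s) y‖ ≤ M₁ := fun s y hy =>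
    (norm_fderiv_timeSlice_le hU s y).trans (hM₁ s y (mem_closedBall_zero_iff.2 hy))
  have hdξ : ∀ y, ‖fderiv ℝ (cutoffScaled R) y‖ ≤ C_Z / R := norm_fderiv_cutoffScaled_le hC_Z hR
  have h₁ : ∀ s y, ‖(fderiv ℝ (cutoffScaled R) y y) • U₀ s y +
      fderiv ℝ (profileCorrector R U₀ s) y y +
      ∑ i, (fderiv ℝ (cutoffScaled R) y (b i)) • fderiv ℝ (U₀ s) y (b i)‖ ≤ K₁ * ρ y := by
    intro s y
    have hterm2 := hDwy s y
    by_cases hzero : fderiv ℝ (cutoffScaled R) y = 0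
    · rw [hzero]
      simp only [_root_.zero_apply, zero_smul, zero_add, Finset.sum_const_zero,
        add_zero]
      refine hterm2.trans (mul_le_mul_of_nonneg_right ?_ (hρ0 y))
      rw [hK₁]
      linarith [mul_nonneg (by positivity : (0 : ℝ) ≤ 2 * C_Z * M₀ + 3 * (C_Z / R * M₁))
        (sq_nonneg (1 + 2 * R))]
    · have hy2 : ‖y‖ ≤ 2 * R := norm_le_of_fderiv_cutoffScaled_ne_zero hR hzero
      have hbr : 1 ≤ (1 + 2 * R) ^ 2 * ρ y := one_le_bracket_mul hy2
      have hterm1 : ‖(fderiv ℝ (cutoffScaled R) y y) • U₀ s y‖ ≤ 2 * C_Z * M₀ := by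
        rw [norm_smul, Real.norm_eq_abs]
        calc |fderiv ℝ (cutoffScaled R) y y| * ‖U₀ s y‖
            ≤ (‖fderiv ℝ (cutoffScaled R) y‖ * ‖y‖) * M₀ :=
              mul_le_mul ((Real.norm_eq_abs _).symm.le.trans (ContinuousLinearMap.le_opNorm _ _))
                (hM₀ s y (mem_closedBall_zero_iff.2 hy2)) (norm_nonneg _) (by positivity)
          _ ≤ (C_Z / R * (2 * R)) * M₀ :=
              mul_le_mul_of_nonneg_right (mul_le_mul (hdξ y) hy2 (norm_nonneg _)
                (by positivity)) hM₀0
          _ = 2 * C_Z * M₀ := by field_simp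
      have hterm3 : ‖∑ i, (fderiv ℝ (cutoffScaled R) y (b i)) • fderiv ℝ (U₀ s) y (b i)‖ ≤
          3 * (C_Z / R * M₁) := by
        refine (norm_sum_le _ _).trans ?_
        have hi : ∀ i, ‖(fderiv ℝ (cutoffScaled R) y (b i)) • fderiv ℝ (U₀ s) y (b i)‖ ≤
            C_Z / R * M₁ := by
          intro i
          rw [norm_smul, Real.norm_eq_abs]
          have hbi : ‖b i‖ = 1 := b.orthonormal.1 i
          calc |fderiv ℝ (cutoffScaled R) y (b i)| * ‖fderiv ℝ (U₀ s) y (b i)‖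
              ≤ (‖fderiv ℝ (cutoffScaled R) y‖ * ‖b i‖) * (‖fderiv ℝ (U₀ s) y‖ * ‖b i‖) :=
                mul_le_mul ((Real.norm_eq_abs _).symm.le.trans (ContinuousLinearMap.le_opNorm _ _))
                  (ContinuousLinearMap.le_opNorm _ _) (norm_nonneg _) (by positivity)
            _ ≤ (C_Z / R * 1) * (M₁ * 1) := by
                rw [hbi]
                exact mul_le_mul (mul_le_mul_of_nonneg_right (hdξ y) zero_le_one)
                  (mul_le_mul_of_nonneg_right (hDU s y hy2) zero_le_one) (by positivity)
                  (by positivity)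
            _ = C_Z / R * M₁ := by ring
        calc ∑ i, ‖(fderiv ℝ (cutoffScaled R) y (b i)) • fderiv ℝ (U₀ s) y (b i)‖
            ≤ ∑ _i : Fin (Module.finrank ℝ (EuclideanSpace ℝ (Fin 3))), C_Z / R * M₁ :=
              Finset.sum_le_sum fun i _ => hi i
          _ = 3 * (C_Z / R * M₁) := by
              rw [Finset.sum_const, Finset.card_univ, Fintype.card_fin, finrank_euclideanSpace_fin,
                nsmul_eq_mul]
              push_cast
              ring
      calc ‖(fderiv ℝ (cutoffScaled R) y y) • U₀ s y + fderiv ℝ (profileCorrector R U₀ s) y y +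
            ∑ i, (fderiv ℝ (cutoffScaled R) y (b i)) • fderiv ℝ (U₀ s) y (b i)‖
          ≤ ‖(fderiv ℝ (cutoffScaled R) y y) • U₀ s y‖ + ‖fderiv ℝ (profileCorrector R U₀ s) y y‖ +
            ‖∑ i, (fderiv ℝ (cutoffScaled R) y (b i)) • fderiv ℝ (U₀ s) y (b i)‖ :=
            norm_add₃_le
        _ ≤ 2 * C_Z * M₀ * 1 + Ky * ρ y + 3 * (C_Z / R * M₁) * 1 := by
            rw [mul_one, mul_one]; exact add_le_add (add_le_add hterm1 hterm2) hterm3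
        _ ≤ 2 * C_Z * M₀ * ((1 + 2 * R) ^ 2 * ρ y) + Ky * ρ y +
            3 * (C_Z / R * M₁) * ((1 + 2 * R) ^ 2 * ρ y) :=
            add_le_add (add_le_add (mul_le_mul_of_nonneg_left hbr (by positivity)) le_rfl)
              (mul_le_mul_of_nonneg_left hbr (by positivity))
        _ = K₁ * ρ y := by rw [hK₁]; ring
  have h₂ : ∀ s i y, ‖(fderiv ℝ (cutoffScaled R) y (b i)) • U₀ s y +
      fderiv ℝ (profileCorrector R U₀ s) y (b i)‖ ≤ K₂ * ρ y := by
    intro s i y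
    have hbi : ‖b i‖ = 1 := b.orthonormal.1 i
    have hterm2 : ‖fderiv ℝ (profileCorrector R U₀ s) y (b i)‖ ≤ A * ρ y := by
      calc ‖fderiv ℝ (profileCorrector R U₀ s) y (b i)‖
          ≤ ‖fderiv ℝ (profileCorrector R U₀ s) y‖ * ‖b i‖ := ContinuousLinearMap.le_opNorm _ _
        _ ≤ A * ρ y * 1 := by rw [hbi]; exact mul_le_mul_of_nonneg_right (hDw s y) zero_le_one
        _ = A * ρ y := mul_one _
    by_cases hzero : fderiv ℝ (cutoffScaled R) y = 0
    · rw [hzero, _root_.zero_apply, zero_smul, zero_add]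
      refine hterm2.trans (mul_le_mul_of_nonneg_right ?_ (hρ0 y))
      rw [hK₂]
      linarith [mul_nonneg (by positivity : (0 : ℝ) ≤ C_Z / R * M₀) (sq_nonneg (1 + 2 * R))]
    · have hy2 : ‖y‖ ≤ 2 * R := norm_le_of_fderiv_cutoffScaled_ne_zero hR hzero
      have hbr : 1 ≤ (1 + 2 * R) ^ 2 * ρ y := one_le_bracket_mul hy2
      have hterm1 : ‖(fderiv ℝ (cutoffScaled R) y (b i)) • U₀ s y‖ ≤ C_Z / R * M₀ := by
        rw [norm_smul, Real.norm_eq_abs]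
        calc |fderiv ℝ (cutoffScaled R) y (b i)| * ‖U₀ s y‖
            ≤ (‖fderiv ℝ (cutoffScaled R) y‖ * ‖b i‖) * M₀ :=
              mul_le_mul ((Real.norm_eq_abs _).symm.le.trans (ContinuousLinearMap.le_opNorm _ _))
                (hM₀ s y (mem_closedBall_zero_iff.2 hy2)) (norm_nonneg _) (by positivity)
          _ ≤ (C_Z / R * 1) * M₀ := by
              rw [hbi]
              exact mul_le_mul_of_nonneg_right (mul_le_mul_of_nonneg_right (hdξ y) zero_le_one) hM₀0
          _ = C_Z / R * M₀ := by ring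
      calc ‖(fderiv ℝ (cutoffScaled R) y (b i)) • U₀ s y + fderiv ℝ (profileCorrector R U₀ s) y (b i)‖
          ≤ C_Z / R * M₀ * 1 + A * ρ y := by
            rw [mul_one]; exact (norm_add_le _ _).trans (add_le_add hterm1 hterm2)
        _ ≤ C_Z / R * M₀ * ((1 + 2 * R) ^ 2 * ρ y) + A * ρ y :=
            add_le_add (mul_le_mul_of_nonneg_left hbr (by positivity)) le_rfl
        _ = K₂ * ρ y := by rw [hK₂]; ring
  refine ⟨(Bt + Bw + K₁ * Bρ + 3 * (K₂ * Bρ)).toNNReal, fun s ζ hζ => ?_⟩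
  have h := abs_lerayPairing_revisedProfile_le hU hleray hR s (Bt := Bt) (Bw := Bw)
    ENNReal.toReal_nonneg ENNReal.toReal_nonneg hK₁0 hK₂0 hρle hBρ0 (h_t s) (h_w s) (h₁ s)
    (fun i y => h₂ s i y) hζ
  refine h.trans (le_of_eq ?_)
  rw [Real.coe_toNNReal _ (by positivity)]


/-! ### The choice of `R₀` -/

/-- **"assuming `R₀` is large enough that `Θ(R₀) ≤ α(1+c_q)⁻¹`"**: for a modulus `Θ(R) → 0`
(in `ℝ≥0∞`), a finite constant `K` and `α > 0` there is `R₀ ≥ 1` with `K Θ(R₀) ≤ α`. [cite: BradshawTsai2017AHP, proof of Lemma 2.5] -/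
theorem exists_radius (Θ : ℝ → ℝ≥0∞) (hΘ : Tendsto Θ atTop (𝓝 0)) {K : ℝ≥0∞} (hK : K ≠ ⊤)
    {α : ℝ} (hα : 0 < α) : ∃ R₀ : ℝ, 1 ≤ R₀ ∧ K * Θ R₀ ≤ ENNReal.ofReal α := by
  by_cases hK0 : K = 0
  · exact ⟨1, le_rfl, by rw [hK0, zero_mul]; exact bot_le⟩
  · have hε : 0 < ENNReal.ofReal α / K :=
      ENNReal.div_pos (ENNReal.ofReal_pos.2 hα).ne' hK
    obtain ⟨N, hN⟩ := ENNReal.tendsto_atTop_zero.1 hΘ _ hε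
    refine ⟨max N 1, le_max_right _ _, ?_⟩
    calc K * Θ (max N 1) ≤ K * (ENNReal.ofReal α / K) :=
          mul_le_mul' le_rfl (hN _ (le_max_left _ _))
      _ = ENNReal.ofReal α := ENNReal.mul_div_cancel hK0 hK

/-- `3 < q` in `ℝ≥0∞` gives `2 ≤ q`. [folklore] -/
theorem two_le_of_three_lt {q : ℝ≥0∞} (hq : 3 < q) : 2 ≤ q :=
  le_trans (by norm_num) hq.le

/-! ### The `L²` clause `U₀ − W ∈ L^∞(0,T;L²)` -/

/-- `∫ ‖f‖ₑ² = ‖f‖_{L²}²` (as real powers). [folklore] -/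
theorem lintegral_enorm_sq_eq_eLpNorm_rpow {X : Type*} [MeasurableSpace X] {μ : Measure X}
    {F' : Type*} [NormedAddCommGroup F'] (f : X → F') :
    ∫⁻ y, ‖f y‖ₑ ^ 2 ∂μ = eLpNorm f 2 μ ^ (2 : ℝ) := by
  have e : ∀ y, ‖f y‖ₑ ^ 2 = ‖f y‖ₑ ^ (2 : ℝ) := fun y => by
    rw [show (2 : ℝ) = ((2 : ℕ) : ℝ) by norm_num, ENNReal.rpow_natCast]
  simp_rw [e]
  rw [lintegral_rpow_enorm_eq_rpow_eLpNorm' two_pos, eLpNorm_eq_eLpNorm' two_ne_zero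
    ENNReal.ofNat_ne_top, ENNReal.toReal_ofNat]

/-- `(1 − ξ_R) U₀(s)` is bounded by `sup_{B̄_{2R}} |U₀(s)|` and vanishes off `B̄(0, 2R)`:
`‖(1−ξ_R)U₀(s)‖_{L²} ≤ |B̄_{2R}|^{1/2} M₀`. [cite: BradshawTsai2017AHP, proof of Lemma 2.5] -/
theorem eLpNorm_one_sub_cutoffScaled_smul_le (hR : 0 < R) {s : ℝ} {M₀ : ℝ}
    (hM₀ : ∀ y ∈ closedBall (0 : EuclideanSpace ℝ (Fin 3)) (2 * R), ‖U₀ s y‖ ≤ M₀) :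
    eLpNorm (fun y => (1 - cutoffScaled R y) • U₀ s y) 2 volume ≤
      (volume (closedBall (0 : EuclideanSpace ℝ (Fin 3)) (2 * R))) ^ (1 / (2 : ℝ)) *
        ENNReal.ofReal M₀ := by
  have e : (fun y => (1 - cutoffScaled R y) • U₀ s y) =
      (closedBall (0 : EuclideanSpace ℝ (Fin 3)) (2 * R)).indicator
        fun y => (1 - cutoffScaled R y) • U₀ s y := by
    funext y
    by_cases hy : y ∈ closedBall (0 : EuclideanSpace ℝ (Fin 3)) (2 * R)
    · rw [indicator_of_mem hy]
    · rw [indicator_of_notMem hy]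
      rw [mem_closedBall_zero_iff, not_le] at hy
      rw [cutoffScaled_eq_one hR hy.le, sub_self, zero_smul]
  rw [e, eLpNorm_indicator_eq_eLpNorm_restrict measurableSet_closedBall]
  have h := eLpNorm_le_of_ae_bound (μ := volume.restrict
    (closedBall (0 : EuclideanSpace ℝ (Fin 3)) (2 * R)))
    (f := fun y => (1 - cutoffScaled R y) • U₀ s y) (p := 2) (C := M₀)
    ((ae_restrict_iff' measurableSet_closedBall).2 (Eventually.of_forall fun y hy => ?_))
  · refine h.trans (le_of_eq ?_)
    rw [Measure.restrict_apply_univ, ENNReal.toReal_ofNat, one_div]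
  · rw [norm_smul, Real.norm_eq_abs]
    have hξ := cutoffZ_mem_Icc (R⁻¹ • y)
    have h1 : |1 - cutoffScaled R y| ≤ 1 := by
      rw [show cutoffScaled R y = cutoffZ (R⁻¹ • y) from rfl, abs_le]
      constructor <;> linarith [hξ.1, hξ.2]
    calc |1 - cutoffScaled R y| * ‖U₀ s y‖ ≤ 1 * M₀ :=
          mul_le_mul h1 (hM₀ y hy) (norm_nonneg _) zero_le_one
      _ = M₀ := one_mul _

/-- **`U₀ − W ∈ L^∞(0,T;L²)`** ([BT1] Lemma 2.5): `sup_s ∫ |U₀(s) − W(s)|² < ∞` for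
`W = revisedProfile R U₀`, `U₀` jointly `C¹` and `T`-periodic, `T > 0`, `R > 0`
(`U₀ − W = (1−ξ)U₀ − w`; both `L²` norms are bounded uniformly in `s`). [cite: BradshawTsai2017AHP, Lemma 2.5] -/
theorem iSup_lintegral_sub_revisedProfile_lt_top (hU : ContDiff ℝ 1 (uncurry U₀)) (hT : 0 < T)
    (hper : ∀ s y, U₀ (s + T) y = U₀ s y) (hR : 0 < R) :
    (⨆ s : ℝ, ∫⁻ y, ‖U₀ s y - revisedProfile R U₀ s y‖ₑ ^ 2) < ⊤ := by
  obtain ⟨M₀, M₁, M₃, hM₀0, -, -, hM₀, -, -⟩ := exists_uniform_bounds hU hT hper R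
  obtain ⟨K2, hK2⟩ := exists_eLpNorm_profileCorrector_le (q := 2) le_rfl
  set vc : ℝ≥0∞ := volume (closedBall (0 : EuclideanSpace ℝ (Fin 3)) (2 * R)) with hvc
  set vb : ℝ≥0∞ := volume (ball (0 : EuclideanSpace ℝ (Fin 3)) (2 * R)) with hvb
  set B : ℝ≥0∞ := vc ^ (1 / (2 : ℝ)) * ENNReal.ofReal M₀ +
    K2 * (vb ^ (1 / (2 : ℝ)) * ENNReal.ofReal M₀) with hB
  have hBtop : B ≠ ⊤ :=
    ENNReal.add_ne_top.2 ⟨ENNReal.mul_ne_top (ENNReal.rpow_ne_top_of_nonneg (by norm_num)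
      measure_closedBall_lt_top.ne) ENNReal.ofReal_ne_top, ENNReal.mul_ne_top ENNReal.coe_ne_top
      (ENNReal.mul_ne_top (ENNReal.rpow_ne_top_of_nonneg (by norm_num) measure_ball_lt_top.ne)
        ENNReal.ofReal_ne_top)⟩
  have hcont : ∀ s, Continuous (U₀ s) := fun s => (contDiff_profileSlice hU s).continuous
  have hWc : ∀ s, Continuous (revisedProfile R U₀ s) := fun s =>
    (contDiff_profileSlice (contDiff_uncurry_revisedProfile hU hR) s).continuous
  have hbound : ∀ s, eLpNorm (fun y => U₀ s y - revisedProfile R U₀ s y) 2 volume ≤ B := by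
    intro s
    have e : (fun y => U₀ s y - revisedProfile R U₀ s y) =
        (fun y => (1 - cutoffScaled R y) • U₀ s y) - profileCorrector R U₀ s := by
      funext y
      rw [Pi.sub_apply, revisedProfile_apply, sub_smul, one_smul]
      abel
    have hm1 : AEStronglyMeasurable (fun y => (1 - cutoffScaled R y) • U₀ s y) volume :=
      ((continuous_const.sub (contDiff_cutoffScaled R (n := 0)).continuous).smul
        (hcont s)).aestronglyMeasurable
    have hm2 : AEStronglyMeasurable (profileCorrector R U₀ s) volume := by
      have e2 : profileCorrector R U₀ s = fun y => revisedProfile R U₀ s y -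
          cutoffScaled R y • U₀ s y := by
        funext y; rw [revisedProfile_apply]; abel
      rw [e2]
      exact ((hWc s).sub ((contDiff_cutoffScaled R (n := 0)).continuous.smul (hcont s))).aestronglyMeasurable
    rw [e]
    refine (eLpNorm_sub_le hm1 hm2 one_le_two).trans (add_le_add ?_ ?_)
    · exact eLpNorm_one_sub_cutoffScaled_smul_le hR (hM₀ s)
    · refine (hK2 hcont hR s).trans (mul_le_mul' le_rfl ?_)
      have h := eLpNorm_indicator_shell_le_of_bound
        (fun z hz => hM₀ s z (mem_closedBall_zero_iff.2 hz)) 2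
      rwa [ENNReal.toReal_ofNat] at h
  refine lt_of_le_of_lt (iSup_le fun s => ?_) (ENNReal.rpow_lt_top_of_nonneg (by norm_num)
    hBtop : B ^ (2 : ℝ) < ⊤)
  rw [lintegral_enorm_sq_eq_eLpNorm_rpow]
  exact ENNReal.rpow_le_rpow (hbound s) (by norm_num)

/-! ### The discharge -/

/-- **[BT1] Lemma 2.5 (Revised asymptotic profile), discharged.** For `T > 0`, `q ∈ (3, ∞]`,
`U₀` under Assumption 2.1 and `α ∈ (0,1)` there is `R₀ ≥ 1` such that
`W = revisedProfile R₀ U₀ = ξ_{R₀}U₀ + w` is `C¹`, `T`-periodic, divergence free, with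
`‖W(s)‖_{L^q} ≤ α`, `W ∈ L^∞L⁴`, `LW ∈ L^∞(0,T;H⁻¹)` (`IsRevisedProfile T q α W`) and
`U₀ − W ∈ L^∞(0,T;L²)`. [cite: BradshawTsai2017AHP, Lemma 2.5] -/
theorem _root_.Literature.Analysis.FluidPDE.bradshawTsai2017_lemma_2_5_holds :
    bradshawTsai2017_lemma_2_5 := by
  intro T hT q hq U₀ hU α hα _hα1
  have hq2 : 2 ≤ q := two_le_of_three_lt hq
  have hq1 : 1 ≤ q := le_trans one_le_two hq2
  have hC1 : ContDiff ℝ 1 (uncurry U₀) := hU.contDiff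
  have hcont : ∀ s, Continuous (U₀ s) := fun s => (contDiff_profileSlice hC1 s).continuous
  obtain ⟨Kq, hKq⟩ := exists_eLpNorm_profileCorrector_le_restrict hq2
  obtain ⟨K4, hK4⟩ := exists_eLpNorm_profileCorrector_le_restrict (q := 4) (by norm_num)
  obtain ⟨Θ, hΘ, hdecay⟩ := hU.decay
  obtain ⟨R₀, hR₀1, hR₀⟩ := exists_radius Θ hΘ (K := 1 + Kq)
    (ENNReal.add_ne_top.2 ⟨ENNReal.one_ne_top, ENNReal.coe_ne_top⟩) hα
  have hR : 0 < R₀ := one_pos.trans_le hR₀1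
  have hWj := contDiff_uncurry_revisedProfile hC1 hR
  have hWc : ∀ s, Continuous (revisedProfile R₀ U₀ s) := fun s =>
    (contDiff_profileSlice hWj s).continuous
  have hVm : ∀ s, AEStronglyMeasurable (fun y => cutoffScaled R₀ y • U₀ s y) volume := fun s =>
    ((contDiff_cutoffScaled R₀ (n := 0)).continuous.smul (hcont s)).aestronglyMeasurable
  have hwm : ∀ s, AEStronglyMeasurable (profileCorrector R₀ U₀ s) volume := by
    intro s
    have e2 : profileCorrector R₀ U₀ s = fun y => revisedProfile R₀ U₀ s y -
        cutoffScaled R₀ y • U₀ s y := by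
      funext y; rw [revisedProfile_apply]; abel
    rw [e2]
    exact ((hWc s).sub ((contDiff_cutoffScaled R₀ (n := 0)).continuous.smul (hcont s))).aestronglyMeasurable
  have hsplit : ∀ s (p : ℝ≥0∞), 1 ≤ p → eLpNorm (revisedProfile R₀ U₀ s) p volume ≤
      eLpNorm (U₀ s) p (volume.restrict (ball (0 : EuclideanSpace ℝ (Fin 3)) R₀)ᶜ) +
        eLpNorm (profileCorrector R₀ U₀ s) p volume := by
    intro s p hp
    have e : revisedProfile R₀ U₀ s = (fun y => cutoffScaled R₀ y • U₀ s y) +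
        profileCorrector R₀ U₀ s := by
      funext y; rw [revisedProfile_apply, Pi.add_apply]
    rw [e]
    exact (eLpNorm_add_le (hVm s) (hwm s) hp).trans
      (add_le_add (eLpNorm_cutoffScaled_smul_le hR (U₀ s) p) le_rfl)
  refine ⟨R₀, hR₀1, ⟨hWj, fun s y => revisedProfile_add_period hU.periodic R₀ s y,
    fun s => isDivFree_revisedProfile hC1 hU.divFree hR s, fun s => ?_, ?_, ?_⟩, ?_⟩
  · -- `‖W(s)‖_{L^q} ≤ (1 + K_q) Θ(R₀) ≤ α`
    calc eLpNorm (revisedProfile R₀ U₀ s) q volume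
        ≤ eLpNorm (U₀ s) q (volume.restrict (ball (0 : EuclideanSpace ℝ (Fin 3)) R₀)ᶜ) +
            eLpNorm (profileCorrector R₀ U₀ s) q volume := hsplit s q hq1
      _ ≤ Θ R₀ + Kq * Θ R₀ :=
          add_le_add (hdecay s R₀) ((hKq hcont hR s).trans (mul_le_mul' le_rfl (hdecay s R₀)))
      _ = (1 + Kq) * Θ R₀ := by ring
      _ ≤ ENNReal.ofReal α := hR₀
  · -- `W ∈ L^∞ L⁴`
    have h4 : ∀ s, eLpNorm (revisedProfile R₀ U₀ s) 4 volume ≤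
        (1 + K4) * ⨆ s, eLpNorm (U₀ s) 4 volume := by
      intro s
      calc eLpNorm (revisedProfile R₀ U₀ s) 4 volume
          ≤ eLpNorm (U₀ s) 4 (volume.restrict (ball (0 : EuclideanSpace ℝ (Fin 3)) R₀)ᶜ) +
              eLpNorm (profileCorrector R₀ U₀ s) 4 volume := hsplit s 4 (by norm_num)
        _ ≤ eLpNorm (U₀ s) 4 volume + K4 * eLpNorm (U₀ s) 4 volume :=
            add_le_add (eLpNorm_mono_measure _ Measure.restrict_le_self)
              ((hK4 hcont hR s).trans (mul_le_mul' le_rfl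
                (eLpNorm_mono_measure _ Measure.restrict_le_self)))
        _ = (1 + K4) * eLpNorm (U₀ s) 4 volume := by ring
        _ ≤ (1 + K4) * ⨆ s, eLpNorm (U₀ s) 4 volume :=
            mul_le_mul' le_rfl (le_iSup (fun s => eLpNorm (U₀ s) 4 volume) s)
    refine lt_of_le_of_lt (iSup_le h4) (ENNReal.mul_lt_top ?_ hU.memL4)
    exact ENNReal.add_lt_top.2 ⟨ENNReal.one_lt_top, ENNReal.coe_lt_top⟩
  · -- `LW ∈ L^∞(0,T;H⁻¹)`
    exact exists_lerayPairing_bound hC1 hT hU.periodic hU.leray hR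
  · -- `U₀ − W ∈ L^∞(0,T;L²)`
    exact iSup_lintegral_sub_revisedProfile_lt_top hC1 hT hU.periodic hR

end BradshawTsai2017

end Literature.Analysis.FluidPDE

end
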